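import Summits.QuantumFields.YangMills.Theorems.IR.ShellMaxCorrDefs
import Summits.QuantumFields.YangMills.Theorems.IR.ShellMaxCorrTensorisation
import HarnessLib

/-!
# Crux `IR` (stmt-QuantumFields-19354) — merged maxcorr line: bankable ENGINE (T1)
«tensorisation of maximal correlation» (ideator ym-ir-idea-1 g0, MECHANISM card §4, 2026-08-28)

**What this is.**  The one tool that bounds a maximal correlation across a JOIN of σ-algebras uniformly in the number of
constituents (no union bound): for independent PAIRS `(𝒜_j ⊔ 𝒞_j)_j`,
`ρ(⨆_j 𝒜_j, ⨆_j 𝒞_j) ≤ max_j ρ(𝒜_j, 𝒞_j)` (Witsenhausen, SIAM J. Appl. Math. 28 (1975) 100–113; Kumar's lemma), stated in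
the tree's operator format of `Literature.MathematicalPhysics.QuantumLattice.TorusWilsonMarkov.maxCorr_sq_le_of_coarse`
(`‖P_X P_Z f − 𝔼f‖₂ ≤ ρ ‖f − 𝔼f‖₂`, i.e. `mK = ⊥`).  Data processing (passing to sub-σ-algebras of the joins) is
already the tree's `TorusWilsonMarkov.maxCorr_sq_le_of_mono`.

**Why it is here.**  `ShellMaxCorr.ShellRung` (maxcorr `≤ ½` across ONE link layer at strong coupling, UNIFORMLY IN THE
RADIUS) is not a corollary of Dobrushin∕Künsch∕Föllmer covariance estimates (oscillation sums grow like `|∂B_R|`); its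
honest route is (T1) below + (T2) a patchwise coupling realising (links in `B_R`, links outside `B_{R+1}`) as sub-algebras
of joins of independent pairs indexed by boundary patches (model step, L, not typed here).  (T1) is pure probability,
certainly true (proof: `L²` of a join of independent algebras is the Hilbert tensor product; `P_{⨆𝒜_j}` acts factorwise on
product functions; the mean-zero part of `⊗_j P_{𝒜_j}P_{𝒞_j}` has norm `max_{S ≠ ∅} ∏_{j∈S} ρ_j ≤ max_j ρ_j` when
`ρ_j ≤ 1`, and conditional expectations are contractions in general), size M∕L in Lean (induction on `J` via the two-pair
case).  Offered to the lead ym-ir-line-mxc-p1 as a support target (`--supports stmt-QuantumFields-19354 --as helper`).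

**PROVED (lead ym-ir-line-mxc-p1 g4, 2026-08-28; helper lane `--supports 19354 --as helper`, 3 files, 0 sorry):**
`Theorems/IR/ShellMaxCorrTensorisationLaw.lean` (p614395: two-block Fubini lemma `two_block` — law of total variance +
two-dimensional Cauchy–Schwarz, the «conditional» proof, no singular values), `…TensorisationFormats.lean` (p615489:
covariance ⇔ operator format, transport along measurable maps by Doob–Dynkin) and `…Tensorisation.lean` (product step,
two independent pairs via the diagonal law `indepFun_iff_map_prod_eq_prod_map_map` + `MeasurableSpace.comap_prodMk`,
`Finset` induction with `indep_iSup_of_disjoint`): `stub_tensorisationEngine` below is now the tree theorem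
`Tensorisation.maxCorr_tensorisation_of_measurable` (type = `TensorisationEngine` verbatim); the stronger all-`f` operator
form is `Tensorisation.maxCorr_tensorisation`.  ELABORATION NOTE on the statement as typed: in `MaxCorrLE μ mX mZ ρ` the
hypothesis `Measurable f` is elaborated against the binder `mZ` (the last `MeasurableSpace Ω` in scope, Lean's rule for
local instances), so the format quantifies over bounded `mZ`-MEASURABLE `f` (for which `P_Z f = f`): it reads
«`‖P_X g − 𝔼g‖₂ ≤ ρ ‖g − 𝔼g‖₂` on `L²(mZ)`», the standard form of maximal correlation `≤ ρ` — equivalent, for `mZ ≤ m0`,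
to the all-`f` form (`Tensorisation.cov_le_of_opBound` / `opBound_of_cov_le`), and both are proved.  Not a registered
stub; no consumer in the skeleton of record (the rung was closed by Dobrushin–Poincaré, p596102): banked support.

**Honesty.** An engine about abstract probability spaces; proves nothing about Yang–Mills.  Nothing in this cell proves the
Clay YM mass gap; R4 closes only the conditional finite-𝕋⁴ rung `BalabanLadder.UV`.
-/

set_option autoImplicit false

noncomputable section

open MeasureTheory ProbabilityTheory

namespace Summit.QuantumFields.YangMills.Cruxes.IR.ShellMaxCorr.Tensorisation

variable {Ω : Type*}

/-- Operator-format maximal-correlation bound between sub-σ-algebras `mX`, `mZ` under `μ`: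
`‖P_X P_Z f − 𝔼f‖₂² ≤ ρ² ‖f − 𝔼f‖₂²` for every bounded measurable `f` (the format of
`TorusWilsonMarkov.maxCorr_sq_le_of_coarse` / `maxCorr_sq_le_of_mono` with the trivial algebra as `mK`). -/
def MaxCorrLE [MeasurableSpace Ω] (μ : Measure Ω) (mX mZ : MeasurableSpace Ω) (ρ : ℝ) : Prop :=
  ∀ f : Ω → ℝ, Measurable f → (∃ M : ℝ, ∀ ω, |f ω| ≤ M) →
    ∫ ω, ((μ[μ[f|mZ]|mX]) ω - ∫ ω', f ω' ∂μ) ^ 2 ∂μ ≤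
      ρ ^ 2 * ∫ ω, (f ω - ∫ ω', f ω' ∂μ) ^ 2 ∂μ

/-- **ENGINE (T1): tensorisation of maximal correlation** (Witsenhausen∕Kumar, σ-algebra form).  For a finite family of
INDEPENDENT pair-algebras `𝒜_j ⊔ 𝒞_j` with `ρ(𝒜_j, 𝒞_j) ≤ ρ` for every `j`, the joins satisfy
`ρ(⨆_j 𝒜_j, ⨆_j 𝒞_j) ≤ ρ` — uniformly in the number of pairs. -/
def TensorisationEngine : Prop :=
  ∀ (Ω : Type) [MeasurableSpace Ω] (μ : Measure Ω) [IsProbabilityMeasure μ]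
    (J : Type) [Fintype J] (mA mC : J → MeasurableSpace Ω),
    (∀ j, mA j ≤ ‹MeasurableSpace Ω›) → (∀ j, mC j ≤ ‹MeasurableSpace Ω›) →
    iIndep (fun j => mA j ⊔ mC j) μ →
    ∀ ρ : ℝ, 0 ≤ ρ → (∀ j, MaxCorrLE μ (mA j) (mC j) ρ) →
      MaxCorrLE μ (⨆ j, mA j) (⨆ j, mC j) ρ

/-- The tensorisation engine — PROVED: the tree theorem `Tensorisation.maxCorr_tensorisation_of_measurable`
(`Theorems/IR/ShellMaxCorrTensorisation.lean`, lead ym-ir-line-mxc-p1 g4), whose type is `TensorisationEngine` unfolded. -/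
theorem stub_tensorisationEngine : TensorisationEngine := maxCorr_tensorisation_of_measurable

end Summit.QuantumFields.YangMills.Cruxes.IR.ShellMaxCorr.Tensorisation

end
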